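import Summits.ABC.ABC.Theorems.EisensteinQuarantine.Negative.EisensteinQuarantineFalseOfForcedPairDepthLaw
import Literature.NumberTheory.EllipticCurves.PastenValuationProductTamagawaProofs
import HarnessLib

/-!
# The refutation floor of `EisensteinQuarantine` (stmt-ABC-15023, route ABC/DefiniteXi) is line-independent

Crux (`Summit.ABC.ABC.Theses.DefiniteXi.EisensteinQuarantine`): `∀ ε > 0 ∃ C`, for all coprime `a, b`
(`ab(a+b) ≠ 0`), `N = N(E_(a,b))`, every admissible `Nm` (odd, squarefree, `ω` odd, `Nm ∣ N`):
`sixPart ξ := ordProj[2] ξ · ordProj[3] ξ ≤ C · N^ε · 𝓛`, `ξ = brandtXi (N/Nm) Nm (a_n(E))`,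
`𝓛 = ∏_{q ∈ N.primeFactors \ Nm.primeFactors} v_q(Δ_min)`.

The crux is census-false AS FILED (standing file `Cruxes/EisensteinQuarantine/Disproof.lean`; negative lemmas
p107253, p107816, p133187, p134266, p135429, p135617 refute it modulo one 2-adic depth law each).  Lead c2 proved
(`isLine_of_forcedPairDepthLaw`, p134266) that the depth law of line `forced-pair-dlog` forces the Frey eigen-lattice
to be a line on an infinite family.  This file (lead c4, 2026-08-17) records the same floor for EVERY refutation,
with no line hypothesis at all:

* `one_le_allowance` — on the crux's domain `𝓛 ≥ 1` (the conductor's primes divide `Δ_min`), so the right-hand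
  side is never the junk value `0`;
* `exists_isLine_of_not_EisensteinQuarantine` — **any proof of `¬ EisensteinQuarantine` produces, for every real
  `C`, admissible data `(a, b, N, Nm)` at which `sixPart ξ > C`, a Brandt setup of type `(N/Nm, Nm)` EXISTS, and in
  EVERY such setup the `a(E_(a,b))`-eigen-lattice of the Brandt matrices is a line `ℤ φ`, `φ ≠ 0`** (off a line
  `ξ = 0` and `sixPart 0 = 1 ≤ C N^ε 𝓛` once `C ≥ 1`).  The eigen-line statement for a Frey curve is Eichler's
  basis problem / Jacquet–Langlands existence plus multiplicity one (the content of the named fact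
  `Literature.NumberTheory.EllipticCurves.takahashi2001_brandtEigenLattice_rank_one` together with modularity):
  every refutation of the crux in this tree therefore contains it on an unbounded set of values of `sixPart ξ`,
  whatever line produces the lower bound.  Since the positive direction is census-false, this is the
  kernel-checked form of "the item as filed cannot close before the eigen-line debt is discharged".

## References

* [PollackWeston2011] R. Pollack, T. Weston, Compos. Math. 147 (2011), §2.1 (`ξ_f(N⁺,N⁻) = ⟨g_f, g_f⟩`).
* [Takahashi2001] S. Takahashi, J. Number Theory 90 (2001), §2 (rank one of the eigen-lattice).
-/

-- `Summit.<Summit>.<Problem>`: for the single-conjunct summit `ABC` the duplicate `ABC.ABC` is mandated.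
set_option linter.dupNamespace false

noncomputable section

open scoped BigOperators
open Literature.NumberTheory.Automorphic Literature.NumberTheory.EllipticCurves

namespace Summit.ABC.ABC.Theorems.EisensteinQuarantine.Negative

/-- **The allowance is a positive integer on the crux's domain**: for `ab(a+b) ≠ 0` and `N = N(E_(a,b))`, every
prime of `N` divides `Δ_min(E_(a,b))` (`primeFactors_conductorNorm_eq`), so
`1 ≤ ∏_{q ∈ N.primeFactors \ s} v_q(Δ_min)` for any excluded set `s`. [folklore] -/
theorem one_le_allowance {a b : ℤ} (h0 : a * b * (a + b) ≠ 0) {N : ℕ}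
    (hN : (freyCurve a b).conductorNorm ℤ = N) (s : Finset ℕ) :
    1 ≤ ∏ q ∈ N.primeFactors \ s, ((freyCurve a b).minimalDiscriminantNorm ℤ).factorization q := by
  haveI := isElliptic_freyCurve h0
  refine Nat.one_le_iff_ne_zero.mpr (Finset.prod_ne_zero_iff.mpr fun q hq => ?_)
  have hq' : q ∈ ((freyCurve a b).minimalDiscriminantNorm ℤ).primeFactors := by
    rw [← primeFactors_conductorNorm_eq (freyCurve a b), hN]
    exact (Finset.mem_sdiff.mp hq).1
  rw [← Nat.support_factorization] at hq'
  exact Finsupp.mem_support_iff.mp hq'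

/-- `sixPart 0 = 1`: at the junk value `ξ = 0` (no line) the left-hand side of the crux is `1`. [folklore] -/
theorem sixPart_zero : ordProj[2] (0 : ℕ) * ordProj[3] (0 : ℕ) = 1 := by
  simp [Nat.factorization_zero]

/-- **The refutation floor, line-independent.**  If `EisensteinQuarantine` fails then for every real `C` there are
coprime `a, b` with `ab(a+b) ≠ 0`, `N = N(E_(a,b)) ≠ 0` and an admissible `Nm` (odd, squarefree, `ω(Nm)` odd,
`Nm ∣ N`) such that `sixPart (brandtXi (N/Nm) Nm (a(E))) > C`, a Brandt setup of type `(N/Nm, Nm)` exists, and in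
EVERY such setup the `a(E)`-eigen-lattice of the Brandt matrices is a line `ℤ φ` with `φ ≠ 0`.  Proof: negate the
crux at `max C 1`; `N^ε ≥ 1` and `𝓛 ≥ 1` (`one_le_allowance`) give `sixPart ξ > max C 1 ≥ 1`, so `ξ ≠ 0`, whereas off
a line `ξ = 0` in every setup (`brandtXi_eq_zero_of_not_isLine`, setup independence `brandtXi_eq_xi`); the setup
exists by `nonempty_xiSetup_freyCurve`.  Hence every refutation of the crux proves the eigen-line statement
(Jacquet–Langlands existence + multiplicity one for `f_E` on the definite algebra) at data with `sixPart ξ`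
unbounded. [folklore] -/
theorem exists_isLine_of_not_EisensteinQuarantine
    (h : ¬ Summit.ABC.ABC.Theses.DefiniteXi.EisensteinQuarantine) (C : ℝ) :
    ∃ a b : ℤ, IsCoprime a b ∧ a * b * (a + b) ≠ 0 ∧ ∃ N : ℕ, N ≠ 0 ∧
      (freyCurve a b).conductorNorm ℤ = N ∧ ∃ Nm : ℕ, Odd Nm ∧ Squarefree Nm ∧
      Odd Nm.primeFactors.card ∧ Nm ∣ N ∧
      C < ((ordProj[2] (brandtXi (N / Nm) Nm (fun n => (freyCurve a b).LFunction n)) *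
          ordProj[3] (brandtXi (N / Nm) Nm (fun n => (freyCurve a b).LFunction n)) : ℕ) : ℝ) ∧
      brandtXi (N / Nm) Nm (fun n => (freyCurve a b).LFunction n) ≠ 0 ∧
      Nonempty (Brandt.XiSetup (N / Nm) Nm) ∧
      ∀ (S : Brandt.XiSetup (N / Nm) Nm) [Fintype (Brandt.ClassSet S.O)],
        ∃ φ : Brandt.ClassSet S.O → ℤ, φ ≠ 0 ∧
          Brandt.eigenLattice (N / Nm * Nm) (Brandt.matrix S.O)
            (fun n => (freyCurve a b).LFunction n) = ℤ ∙ φ := by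
  unfold Summit.ABC.ABC.Theses.DefiniteXi.EisensteinQuarantine at h
  push Not at h
  obtain ⟨ε, hε, hC⟩ := h
  obtain ⟨a, b, hab, h0, N, hNe, hN, Nm, hodd, hsq, hcard, hdvd, hlt⟩ := hC (max C 1)
  have hN0 : N ≠ 0 := hNe.ne
  -- `max C 1 ≤ max C 1 · N^ε · 𝓛 < sixPart ξ`
  have hNε : (1 : ℝ) ≤ (N : ℝ) ^ ε :=
    Real.one_le_rpow (by exact_mod_cast Nat.one_le_iff_ne_zero.mpr hN0) hε.le
  have hL : (1 : ℝ) ≤ ((∏ q ∈ N.primeFactors \ Nm.primeFactors,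
      ((freyCurve a b).minimalDiscriminantNorm ℤ).factorization q : ℕ) : ℝ) := by
    exact_mod_cast one_le_allowance h0 hN Nm.primeFactors
  have hmax : max C 1 ≤ max C 1 * (N : ℝ) ^ ε *
      ((∏ q ∈ N.primeFactors \ Nm.primeFactors,
        ((freyCurve a b).minimalDiscriminantNorm ℤ).factorization q : ℕ) : ℝ) := by
    have h1 : (0 : ℝ) ≤ max C 1 := le_trans zero_le_one (le_max_right _ _)
    calc max C 1 = max C 1 * 1 * 1 := by ring
      _ ≤ max C 1 * (N : ℝ) ^ ε * ((∏ q ∈ N.primeFactors \ Nm.primeFactors,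
            ((freyCurve a b).minimalDiscriminantNorm ℤ).factorization q : ℕ) : ℝ) := by
          gcongr
  have hbig := lt_of_le_of_lt hmax hlt
  have hCl : C < _ := lt_of_le_of_lt (le_max_left C 1) hbig
  have h1l : (1 : ℝ) < _ := lt_of_le_of_lt (le_max_right C 1) hbig
  -- `sixPart ξ > 1` forces `ξ ≠ 0`
  have hxi : brandtXi (N / Nm) Nm (fun n => (freyCurve a b).LFunction n) ≠ 0 := by
    intro hz
    rw [hz, sixPart_zero] at h1l
    norm_num at h1l
  have hne : Nonempty (Brandt.XiSetup (N / Nm) Nm) := by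
    have := XiBound.Negative.nonempty_xiSetup_freyCurve hab h0 hodd hsq hcard (hN ▸ hdvd)
    rwa [hN] at this
  refine ⟨a, b, hab, h0, N, hN0, hN, Nm, hodd, hsq, hcard, hdvd, hCl, hxi, hne, fun S _ => ?_⟩
  by_contra hline
  exact hxi (brandtXi_eq_zero_of_not_isLine S _ hline)

end Summit.ABC.ABC.Theorems.EisensteinQuarantine.Negative

end
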